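import Literature.MathematicalPhysics.QuantumFieldTheory.Balaban1983to89.B9SectECov

/-!
# `Balaban1983to89.B13Resolvent27` — T. Bałaban, *Renormalization group approach to lattice gauge field theories.
II. Cluster expansions*, Commun. Math. Phys. **116** (1988) 1–22 [Balaban1988RG2Cluster]: the representation of the
resolvent `C(xI + C*Δ_kC)⁻¹C*` after (2.7) p. 13 (the «additional term» `−½x‖χ*(QA + D̄μ(QA))‖²` under the
exponential of (3.185) [13]) — a (2.7rw)-tagged NAMED INSTANCE of the tree's kernel theorem
`B9SectECov.b10_rep63_of_3185`

statement-level skeleton of published theorems with citation tags; proofs where landed; nothing here is a claim about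
the Yang–Mills mass gap

PDF held: `paper:balaban1988-cmp116-rg-ii-cluster` (journal page = PDF page + 0); p. 13 read as an image from
`run/shared/lean/pub/pub-balaban/b2b-balaban-ref1/pages/1988-cmp116-rg-II-cluster/1988-cmp116-rg-II-cluster-p013-x2.png`
(and `…-p013-x4.png`).

CITATION HEADER (p. 13 [PDF 13], the paragraph after (2.7), verbatim): *"Expanding the operator Δ_k into the
generalized random walks, we obtain an expansion of the series above, if γ₁ is sufficiently large. The resolvent
(xI + C\*Δ_kC)⁻¹ has a representation similar to (C\*Δ_kC)⁻¹. More exactly, the operator C(xI + C\*Δ_kC)⁻¹C\* is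
representated by the integral (3.185) [13] with the additional term −½x‖χ\*(QA + D̄μ(QA))‖² under the exponential
function, where χ\* is the characteristic function of the set of bonds T₁^{(k)}∖{b₀(c) : c ∈ T^{(k+1)}}. This term
determines a nonnegative, bounded and almost local operator. The integral yields the representation (3.185) [13], with
the operator G̃₂ replaced by G̃₃(x), which is defined as G̃₂, but with this additional operator. The operator G̃₃(x)
has the same properties as G̃₂, especially it can be expanded into a generalized random walk expansion. This yields an
expansion of the integral above, hence an expansion of (C^{(k)})^{1/2} also."*  (The diacritic on `D` — bar — is that
of [13] (3.183)–(3.185); the renders do not separate bar from tilde at this size.)  [13] = T. Bałaban, *Propagators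
for lattice gauge theories in a background field*, Commun. Math. Phys. **99** (1985) 389–434
[Balaban1985BackgroundPropagators] (= B9), (3.183)–(3.186) p. 432; the same device is B10 = [16] (63) p. 272
[Balaban1985UV3] (*"see (63) [16]"*, p. 13).

WHAT IS REPRODUCED (unit `lit-balaban-r10` gen 2, reader/typer of CMP 116; SKELETON row `B13.Eq2.7rw` of
`HOME/lit-balaban-r10/ROWS-B13.md` — «absent (by assertion)» at SKELETON v3.8, ranked in the lead's `ABSENT-RANKED.md`
(156 dependants)).  The tree ALREADY holds the kernel content of the quoted sentence, proved for finite matrices over a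
field in `B9SectECov` §6 (cell `pub-balaban`, sub-cell b2b-balaban-b09): with `𝒢 = flucCov K Q̃` the covariance `G̃₂`
of the constrained Gaussian integral (3.183) (form `K` in the variable `A`, constraint `δ(Q̃A)`), `P` the observation
`A ↦ QA + D̄μ(QA)`, (3.185)+(3.157) as the hypothesis `P·G̃₂·Pᵀ = C·T⁻¹·Cᵀ` (`T = C*Δ_kC`) and the `Λ̃`-coordinates
`χ` with `χC = 1` ((3.158)), TILTING the form by `x·(χP)ᵀ(χP)` — i.e. adding `½x‖χ(QA + D̄μ(QA))‖²` under the
exponential — gives the observed covariance `C·(T + x)⁻¹·Cᵀ` (`B9SectECov.b10_rep63_of_3185`, constrained Woodbury),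
tagged there for B10 (63) and B9 (3.185).  This file adds NOTHING mathematical: it records the B13 sentence as the
(2.7rw)-tagged named instance, in B13's order `xI + C*Δ_kC`:
* `addTerm27` — the «additional term» as the tilt of the quadratic form, `x·(χ*P)ᵀ(χ*P)` (so that
  `½⟨A, addTerm27·A⟩ = ½x‖χ*(PA)‖²`, `addTerm27_quadForm`), with `addTerm27_eq_tilt` (= `B9SectECov`'s tilt
  expression) and, over `ℝ`, `addTerm27_quadForm_nonneg` (*"nonnegative"*, for `x ≥ 0`);
* `resolvent_rep_27` — *"the operator C(xI + C\*Δ_kC)⁻¹C\* is representated by the integral (3.185) [13] with the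
  additional term"*: `P·flucCov (K + addTerm27)·Pᵀ = C·(x·1 + T)⁻¹·Cᵀ` (general field; invertibility hypotheses as in
  `B9SectECov`), `resolvent_rep_27_restrict` (its `Λ̃`-block `= (x·1 + T)⁻¹`, *"G̃₂ replaced by G̃₃(x)"* read on the
  resolvent), `resolvent_rep_27_real` (over `ℝ` with `T = C*Δ_kC` positive definite — [13] p. 428 *"a positive definite
  operator C\*Δ_kC with a lower bound γ₀ > 0"* — and `x > 0`, the only remaining hypothesis being the nonsingularity of
  the bordered matrix of (3.183)), and `resolvent_rep_27_zero` (at `x = 0` the tilt vanishes and the statement is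
  (3.185) itself — the endpoint of *"uniformly in x ∈ [0, γ₁]"* is covered trivially).
NOT TYPED (by reference, as the print has it): the generalized random walk expansion of `G̃₃(x)` (*"has the same
properties as G̃₂"*) — the B10 (63) carriers `B10Eq63Rep.G3Rep` / `B10LogDet63.G3WalkBound` (hypothesis-style) and
the B9 Sect. C rows are the tree's records; *"bounded and almost local"* likewise.  No named fact (D-0026): every
`Prop` below is a proved `theorem`; the one `def` is the printed object.
HOME: `run/shared/lean/pub/lit-balaban/` (ROWS-B13.md row B13.Eq2.7rw; DEPGRAPH edges B13.Eq2.7rw → B9.Eq3.185,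
B10.Eq63).
-/

namespace Literature.MathematicalPhysics.QuantumFieldTheory.Balaban1983to89.B13Resolvent27

open Matrix
open scoped Matrix
open Literature.MathematicalPhysics.QuantumFieldTheory.Balaban1983to89.Beta.Composition (kkt)
open Literature.MathematicalPhysics.QuantumFieldTheory.Balaban1983to89.Beta.CompositionSingular (flucCov)
open Literature.MathematicalPhysics.QuantumFieldTheory.Balaban1983to89.B9SectECov

section General

variable {𝕜 : Type*} [Field 𝕜]
variable {ν μ α σ : Type*} [Fintype ν] [Fintype μ] [Fintype α] [Fintype σ]
variable [DecidableEq ν] [DecidableEq μ] [DecidableEq σ]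

/-- **The «additional term» of p. 13** as the tilt of the quadratic form of (3.185) [13]: with `P` the observation
`A ↦ QA + D̄μ(QA)` (matrix `α × ν`, `ν` = the coordinates of `A`) and `χ = χ*` the coordinates of the bonds
`T₁^{(k)}∖{b₀(c) : c ∈ T^{(k+1)}}` (matrix `σ × α`), the term `½x‖χ*(QA + D̄μ(QA))‖²` added under `exp(−…)` is the
form `½⟨A, addTerm27·A⟩` with `addTerm27 = x·(χP)ᵀ(χP)` (`addTerm27_quadForm`).  (Existing carrier of the same
tilt, B10/B9-tagged: the expression `(χ * P)ᵀ * (x • 1) * (χ * P)` of `B9SectECov.b10_rep63_of_3185`,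
`addTerm27_eq_tilt`.) [cite: Balaban1988RG2Cluster, p.13 (after (2.7))] -/
def addTerm27 (x : 𝕜) (χ : Matrix σ α 𝕜) (P : Matrix α ν 𝕜) : Matrix ν ν 𝕜 :=
  x • ((χ * P)ᵀ * (χ * P))

omit [Fintype ν] [DecidableEq ν] in
/-- `addTerm27` is `B9SectECov`'s tilt `(χP)ᵀ·(x·1)·(χP)`. [cite: Balaban1988RG2Cluster, p.13 (after (2.7))] -/
theorem addTerm27_eq_tilt (x : 𝕜) (χ : Matrix σ α 𝕜) (P : Matrix α ν 𝕜) :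
    addTerm27 x χ P = (χ * P)ᵀ * (x • (1 : Matrix σ σ 𝕜)) * (χ * P) := by
  rw [addTerm27, Matrix.mul_smul, Matrix.mul_one, Matrix.smul_mul]

omit [DecidableEq ν] [DecidableEq σ] in
/-- As a quadratic form: `⟨A, addTerm27·A⟩ = x·‖χ*(PA)‖²` (sum of squares of the `Λ̃`-coordinates of `PA`), i.e. the
printed `½x‖χ*(QA + D̄μ(QA))‖²` after the factor `½`. [cite: Balaban1988RG2Cluster, p.13 (after (2.7))] -/
theorem addTerm27_quadForm (x : 𝕜) (χ : Matrix σ α 𝕜) (P : Matrix α ν 𝕜) (A : ν → 𝕜) :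
    A ⬝ᵥ (addTerm27 x χ P *ᵥ A) = x * ((χ * P) *ᵥ A ⬝ᵥ (χ * P) *ᵥ A) := by
  rw [addTerm27, Matrix.smul_mulVec, dotProduct_smul, smul_eq_mul, ← Matrix.mulVec_mulVec,
    Matrix.dotProduct_mulVec, Matrix.vecMul_transpose]

/-- **p. 13, the representation of the resolvent**, verbatim *"the operator C(xI + C\*Δ_kC)⁻¹C\* is representated by
the integral (3.185) [13] with the additional term −½x‖χ\*(QA + D̄μ(QA))‖² under the exponential function"* — kernel
form: if the (3.183)-integral (form `K`, constraint `Q̃ = Q`) represents `C·T⁻¹·Cᵀ` through the observation `P`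
((3.185) with (3.157), hypothesis `h3185`; `T = C*Δ_kC`) and `χC = 1` ((3.158)), then the TILTED integral represents
`C·(xI + T)⁻¹·Cᵀ`.  The named B13 instance of `B9SectECov.b10_rep63_of_3185` (there in the order `T + xI` of B10
(63)); nonsingularity hypotheses on the bordered matrix of `(K, Q)`, on `T` and on `x⁻¹ + T⁻¹`, `x ≠ 0` (over `ℝ`:
`resolvent_rep_27_real`). [cite: Balaban1988RG2Cluster, p.13 (after (2.7))] -/
theorem resolvent_rep_27 (K : Matrix ν ν 𝕜) (Q : Matrix μ ν 𝕜) (P : Matrix α ν 𝕜) (χ : Matrix σ α 𝕜)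
    (C : Matrix α σ 𝕜) (T : Matrix σ σ 𝕜) (x : 𝕜) (hx : x ≠ 0) (hW : IsUnit (kkt K Q).det) (hT : IsUnit T.det)
    (hM : IsUnit (x⁻¹ • (1 : Matrix σ σ 𝕜) + T⁻¹).det)
    (h3185 : P * flucCov K Q * Pᵀ = C * T⁻¹ * Cᵀ) (hχ : χ * C = 1) :
    P * flucCov (K + addTerm27 x χ P) Q * Pᵀ = C * (x • (1 : Matrix σ σ 𝕜) + T)⁻¹ * Cᵀ := by
  rw [addTerm27_eq_tilt, add_comm (x • (1 : Matrix σ σ 𝕜)) T]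
  exact b10_rep63_of_3185 K Q P χ C T x hx hW hT hM h3185 hχ

/-- … restricted to the `Λ̃`-coordinates (*"the integral yields the representation (3.185) [13], with the operator G̃₂
replaced by G̃₃(x)"*, read on the resolvent): the `χ`-block of the tilted observed covariance is `(xI + C*Δ_kC)⁻¹`
itself ((3.158) form).  Instance of `B9SectECov.b10_rep63_restrict`. [cite: Balaban1988RG2Cluster, p.13 (after (2.7))] -/
theorem resolvent_rep_27_restrict (K : Matrix ν ν 𝕜) (Q : Matrix μ ν 𝕜) (P : Matrix α ν 𝕜) (χ : Matrix σ α 𝕜)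
    (C : Matrix α σ 𝕜) (T : Matrix σ σ 𝕜) (x : 𝕜) (hx : x ≠ 0) (hW : IsUnit (kkt K Q).det) (hT : IsUnit T.det)
    (hM : IsUnit (x⁻¹ • (1 : Matrix σ σ 𝕜) + T⁻¹).det)
    (h3185 : P * flucCov K Q * Pᵀ = C * T⁻¹ * Cᵀ) (hχ : χ * C = 1) :
    χ * (P * flucCov (K + addTerm27 x χ P) Q * Pᵀ) * χᵀ = (x • (1 : Matrix σ σ 𝕜) + T)⁻¹ := by
  rw [addTerm27_eq_tilt, add_comm (x • (1 : Matrix σ σ 𝕜)) T]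
  exact b10_rep63_restrict K Q P χ C T x hx hW hT hM h3185 hχ

/-- The endpoint `x = 0` of *"uniformly in x ∈ [0, γ₁]"* (p. 13, the first integral of (2.7)): the additional term
vanishes and the statement is the hypothesis (3.185) itself. [cite: Balaban1988RG2Cluster, p.13 (after (2.7))] -/
theorem resolvent_rep_27_zero (K : Matrix ν ν 𝕜) (Q : Matrix μ ν 𝕜) (P : Matrix α ν 𝕜) (χ : Matrix σ α 𝕜)
    (C : Matrix α σ 𝕜) (T : Matrix σ σ 𝕜) (h3185 : P * flucCov K Q * Pᵀ = C * T⁻¹ * Cᵀ) :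
    P * flucCov (K + addTerm27 0 χ P) Q * Pᵀ = C * ((0 : 𝕜) • (1 : Matrix σ σ 𝕜) + T)⁻¹ * Cᵀ := by
  rw [addTerm27, zero_smul, add_zero, zero_smul, zero_add, h3185]

end General

/-! ## Over `ℝ`: `T = C*Δ_kC` positive definite, `x > 0` -/

section Real

variable {ν μ α σ : Type*} [Fintype ν] [Fintype μ] [Fintype α] [Fintype σ]
variable [DecidableEq ν] [DecidableEq μ] [DecidableEq σ]

omit [DecidableEq ν] [DecidableEq σ] in
/-- *"This term determines a nonnegative … operator"* (p. 13): for `x ≥ 0` the tilt form `⟨A, addTerm27·A⟩ =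
x‖χ*(PA)‖²` is nonnegative. [cite: Balaban1988RG2Cluster, p.13 (after (2.7))] -/
theorem addTerm27_quadForm_nonneg {x : ℝ} (hx : 0 ≤ x) (χ : Matrix σ α ℝ) (P : Matrix α ν ℝ) (A : ν → ℝ) :
    0 ≤ A ⬝ᵥ (addTerm27 x χ P *ᵥ A) := by
  rw [addTerm27_quadForm]
  refine mul_nonneg hx ?_
  exact Finset.sum_nonneg fun i _ => mul_self_nonneg _

/-- **p. 13 over `ℝ`**: with `T = C*Δ_kC` positive definite ([13] p. 428: *"a positive definite operator C\*Δ_kC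
with a lower bound γ₀ > 0 independent of k and U"*) and `x > 0` (the integration variable of (2.7)), the tilted
(3.183)-integral represents `C(xI + C*Δ_kC)⁻¹C*` and its `Λ̃`-block is `(xI + C*Δ_kC)⁻¹`; the only hypothesis left is
the nonsingularity of the bordered matrix of (3.183).  Instance of `B9SectECov.b10_rep63_real`.
[cite: Balaban1988RG2Cluster, p.13 (after (2.7))] -/
theorem resolvent_rep_27_real (K : Matrix ν ν ℝ) (Q : Matrix μ ν ℝ) (P : Matrix α ν ℝ) (χ : Matrix σ α ℝ)
    (C : Matrix α σ ℝ) (T : Matrix σ σ ℝ) (hT : T.PosDef) {x : ℝ} (hx : 0 < x) (hW : IsUnit (kkt K Q).det)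
    (h3185 : P * flucCov K Q * Pᵀ = C * T⁻¹ * Cᵀ) (hχ : χ * C = 1) :
    P * flucCov (K + addTerm27 x χ P) Q * Pᵀ = C * (x • (1 : Matrix σ σ ℝ) + T)⁻¹ * Cᵀ ∧
      χ * (P * flucCov (K + addTerm27 x χ P) Q * Pᵀ) * χᵀ = (x • (1 : Matrix σ σ ℝ) + T)⁻¹ := by
  rw [addTerm27_eq_tilt, add_comm (x • (1 : Matrix σ σ ℝ)) T]
  exact b10_rep63_real K Q P χ C T hT hx hW h3185 hχ

end Real

end Literature.MathematicalPhysics.QuantumFieldTheory.Balaban1983to89.B13Resolvent27
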